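/-
Copyright (c) 2026 the pub-hodgecm-mathlib formalisation cell (harness21).  Prover seat hodgecm-mathlib-K2E4-p14 (g7): Track B «K2-LIT», ENGINE E1,
h413 = stmt-HodgeConjecture-24833; DEAL (23)∕RULING (31) of K2E1-plan (g6), FILE 1 §2: «THE REAL-σ PAY-OUT — (R-b)₃ LETTER-FREE».
-/
import Summits.HodgeConjecture.HodgeConjecture.Theorems.K2E1ResidueUniformMajorantCMThreeLetters    -- ★ p859127 (K2E1 g6): the real door `residue_uniform_majorant_cm_three_of_cbound` (letter `hcb`)
import Summits.HodgeConjecture.HodgeConjecture.Theorems.K2E1IntertwiningArchFactorIntegrableU3      -- ★ p859299 (this seat, (α)): `norm_integral_integral_arch_rpow_le`; brings ★ FILE 3′ `…FiniteIntegrabilityU3`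
import Summits.HodgeConjecture.HodgeConjecture.Theorems.K2E1IntertwiningLocalFactorIntegrableU3     -- ★ (this seat, (β)): `norm_localMean_le_cm` (every place); brings ★ `…LocalMeanCMU3`
import Summits.HodgeConjecture.HodgeConjecture.Theorems.K2E1IntertwiningScalarContinuationU3       -- ★ FILE 1 (K2E2-p12): `exists_differentiableOn_sub_two_mul_scalar_cm` (`(σ−2)·[N∕D](σ) = G σ`, `G` holomorphic on `{1 < re}`)
import Summits.HodgeConjecture.HodgeConjecture.Theorems.K2E1IntertwinedCoeffContinuousCM           -- ★ (this seat's lineage): `integrable_borelHeight_weylLongU_mul_rpow_cm_three` (Godement, `hT`, letter-free at CM)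
import Summits.HodgeConjecture.HodgeConjecture.Theorems.K2E1HeisenbergHaarU3                        -- ★ (ν-2): `isInvInvariant_of_isHaarMeasure_adelicUnipotent_three`
import Summits.HodgeConjecture.HodgeConjecture.Theorems.K2E1WhittakerLocalUnitValuesCofiniteU3      -- ★ (K2E1-p10): brings the cofinite suppliers `finite_setOf_not_isUnramifiedIn`, `eventually_valued_algebraMap_eq_one`, `eventually_forall_placesOver`
import Literature.NumberTheory.Automorphic.UnitaryGroupIwasawaAdelic                               -- ★ `exists_mem_borelAdelic_mul_mem_standardMaximalCompactGL_cm_three` (Iwasawa at CM, `hIw`)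
import Literature.NumberTheory.Rogawski1990.LocalTransferAtOneMuTwistGlobal                        -- ★ `isUnramifiedAt_quadraticHeckeCharCM_of_isUnramifiedIn`
import Literature.NumberTheory.Automorphic.AdicCompletionCompact                                   -- ★ `locallyCompactSpace_adicCompletion`, `locallyCompactSpace_finiteAdeleRing'`, `locallyCompactSpace_adeleRing'`
import HarnessLib

/-!
# K2·E1 — `K2E1ResidueUniformMajorantCMThreeScalar` (DEAL (23)∕(31) FILE 1 §2): THE REAL-`σ` PAY-OUT — `(σ − 2)·‖c_ν(σ)‖ ≤ M` ON `(2, 3]` FOR THE SCALAR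
# `c_ν(σ) = ν(𝓕)⁻¹·∫_{N(𝔸)} H(ι(w₀)v)^σ dν` OF THE SPHERICAL `U(2,1)` EISENSTEIN SERIES — AND (R-b)₃ LETTER-FREE: `residue_uniform_majorant_cm_three`

Track B ∕ K2-LIT, crux h413 = `stmt-HodgeConjecture-24833`, route of record `HCCMUnconditional`; cell `hodgecm-mathlib`, squad K2, ENGINE E1 (campaign «EIS-RANK-ONE», R7 at `N = 3`).
THEOREMS ONLY (no `def`, no instance, no notation, no named-fact hypothesis, no `sorry`; default heartbeats); lane `--supports stmt-HodgeConjecture-24833 --as helper` (count-neutral).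

THE MATHEMATICS [MoeglinWaldspurger1995, II.1.7, IV.1.11; Langlands1971, §3; Langlands1976, Appendix].  For real `σ > 2` the Euler product ★ FILE 3′
`K2E1IntertwiningFiniteIntegrabilityU3.exists_pos_inv_measure_smul_integral_rpow_borelHeight_eq_eulerProduct_three'` reads
  `c_ν(σ) = C · A(σ) · (∏_{v ∈ S₀} a_v(σ)) · [N∕D](σ)`,  `A(σ) = ∫∫ ARCH₃^{−σ}`, `a_v(σ) = ν_v³(𝒪³)⁻¹∫ Q_v^{−σ}`, `[N∕D] = ζ^{S₀}(σ−1)L^{S₀}(σ−1,ε)L^{S₀}(2σ−2,ε) ∕ ζ^{S₀}(σ)L^{S₀}(σ,ε)L^{S₀}(2σ−1,ε)`,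
with `S₀` the finite set of places of `L⁺` that are ramified in `L`, divide `2`, or where `δ` is not a unit (cofinite suppliers ★), `hT` by Godement at CM (★
`integrable_borelHeight_weylLongU_mul_rpow_cm_three`), Iwasawa at CM (★), `N(𝔸)` inversion-invariant (★).  UNIFORMLY for `σ ∈ (2, 3]`: `‖A(σ)‖ ≤ A(2) < ∞` (★ (α)
`norm_integral_integral_arch_rpow_le` — the archimedean factor is integrable down to `σ > 1`), `‖a_v(σ)‖ ≤ a_v(2) < ∞` (★ (β) `norm_localMean_le_cm` — EVERY place, down to `σ > 3∕2`,
in particular the bad places of `S₀`), and `(σ − 2)·[N∕D](σ) = G(σ)` with `G` holomorphic on `{Re > 1}` (★ FILE 1 `exists_differentiableOn_sub_two_mul_scalar_cm`), hence bounded on the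
compact segment `[2, 3]`.  So `(σ − 2)·‖c_ν(σ)‖ ≤ C·A(2)·∏_{v∈S₀} a_v(2)·max_{[2,3]}‖G‖ =: M` — the letter `hcb` of ★ `residue_uniform_majorant_cm_three_of_cbound` with `η₁ = 1`.
* §1 `payout_arith` (the bookkeeping inequality), `norm_prod_le_prod_of_le`, `integral_cpow_eq_integral_rpow` (the door's `(H : ℂ)^{(σ:ℂ)}` currency = ★ FILE 3′'s `((H^σ : ℝ) : ℂ)`).
* §2 **`sub_two_mul_norm_intertwiningScalar_le_cm_three`** — `∃ M, ∀ σ ∈ (2, 3], (σ − 2)·‖c_ν(σ)‖ ≤ M` for EVERY Haar `ν` on `N(𝔸_{L⁺})` and fundamental domain `𝓕` of `N(L⁺)` with compact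
  closure (all auxiliary Haar measures and Borel structures are CHOSEN inside the proof: `Measure.addHaar`).
* §3 **`residue_uniform_majorant_cm_three`** (HEAD, (R-b)₃ LETTER-FREE): for `φ₀ : ℂ` and ANY `A > 2`, `∃ η > 0, ∃ C ≥ 0, ∀ σ ∈ (2, 2+η], ∀ g, (σ − 2)·‖E(φ₀H^σ)(g)‖ ≤ C·w₁(g)^A`;
  `_le_max` and `_siegel` forms.
HONEST LABEL: HC_CM is proved only modulo the 7 printed citations (2 remaining named inputs: hLiu418 = `stmt-HodgeConjecture-24832`, h413 = `stmt-HodgeConjecture-24833`) until rung 0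
closes; this file asserts no named fact and closes no socket; count-neutral; unconditional (no letter: Godement, Iwasawa, the Euler product, the local and archimedean integrability are all ★).

## References
* [MoeglinWaldspurger1995] C. Mœglin, J.-L. Waldspurger, *Spectral Decomposition and Eisenstein Series* (1995): II.1.5, II.1.7, IV.1.11.
* [Langlands1971] R. P. Langlands, *Euler Products* (1971): §3.
* [Langlands1976] R. P. Langlands, *On the Functional Equations Satisfied by Eisenstein Series*, LNM 544 (1976): Appendix.
-/

set_option autoImplicit false
set_option linter.dupNamespace false -- the mandated namespace repeats `HodgeConjecture.HodgeConjecture`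

noncomputable section

open MeasureTheory MeasureTheory.Measure NumberField NumberField.InfinitePlace IsDedekindDomain Set Filter Topology
open scoped ENNReal NNReal Classical
open Literature.NumberTheory.Automorphic Literature.NumberTheory.Automorphic.UnitaryGroup Literature.NumberTheory.GaloisRepresentations Literature.NumberTheory.LFunctions AdelicGroupData
open Literature.NumberTheory.GaloisRepresentations.IsNonarchimedeanLocalField
open Summit.HodgeConjecture.HodgeConjecture.Cruxes.H413
open Summit.HodgeConjecture.HodgeConjecture.Cruxes.H413.K2E1BorelEisensteinU
open Summit.HodgeConjecture.HodgeConjecture.Cruxes.H413.K2E1ResidueUniformMajorantCMThreeLetters (residue_uniform_majorant_cm_three_of_cbound residue_uniform_majorant_cm_three_of_cbound_le_max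
  residue_uniform_majorant_cm_three_of_cbound_siegel)
open Summit.HodgeConjecture.HodgeConjecture.Cruxes.H413.K2E1IntertwiningArchFactorIntegrableU3 (norm_integral_integral_arch_rpow_le)
open Summit.HodgeConjecture.HodgeConjecture.Cruxes.H413.K2E1IntertwiningLocalFactorIntegrableU3 (norm_localMean_le_cm)
open Summit.HodgeConjecture.HodgeConjecture.Cruxes.H413.K2E1IntertwiningFiniteIntegrabilityU3 (exists_pos_inv_measure_smul_integral_rpow_borelHeight_eq_eulerProduct_three')
open Summit.HodgeConjecture.HodgeConjecture.Cruxes.H413.K2E1IntertwiningScalarContinuationU3 (exists_differentiableOn_sub_two_mul_scalar_cm)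
open Summit.HodgeConjecture.HodgeConjecture.Cruxes.H413.K2E1IntertwinedCoeffContinuousCM (integrable_borelHeight_weylLongU_mul_rpow_cm_three)
open Summit.HodgeConjecture.HodgeConjecture.Cruxes.H413.K2E1HeisenbergHaarU3 (isInvInvariant_of_isHaarMeasure_adelicUnipotent_three)

namespace Summit.HodgeConjecture.HodgeConjecture.Cruxes.H413.K2E1ResidueUniformMajorantCMThreeScalar

/-! ## §1 Bookkeeping -/

/-- The pay-out arithmetic: if `c = C·X·(Y·Z)` with `‖X‖ ≤ A₂`, `‖Y‖ ≤ P`, `(σ − 2)·Z = g` and `‖g‖ ≤ M_G` (`C ≥ 0`, `σ > 2`), then `(σ − 2)·‖c‖ ≤ C·A₂·P·M_G`. [folklore] -/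
theorem payout_arith {C A₂ P MG σ : ℝ} {c X Y Z g : ℂ} (hC : 0 ≤ C) (hσ : 2 < σ) (hE : c = (C : ℂ) * X * (Y * Z))
    (hX : ‖X‖ ≤ A₂) (hY : ‖Y‖ ≤ P) (hg : ((σ : ℂ) - 2) * Z = g) (hgM : ‖g‖ ≤ MG) :
    (σ - 2) * ‖c‖ ≤ C * A₂ * P * MG := by
  have hZ : (σ - 2) * ‖Z‖ ≤ MG := by
    have h1 : ‖((σ : ℂ) - 2) * Z‖ = (σ - 2) * ‖Z‖ := by
      rw [norm_mul, show ((σ : ℂ) - 2) = ((σ - 2 : ℝ) : ℂ) by push_cast; ring, Complex.norm_real, Real.norm_of_nonneg (by linarith)]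
    rw [← h1, hg]
    exact hgM
  have hA₂ : 0 ≤ A₂ := (norm_nonneg _).trans hX
  have hP : 0 ≤ P := (norm_nonneg _).trans hY
  rw [hE, norm_mul, norm_mul, norm_mul, Complex.norm_real, Real.norm_of_nonneg hC]
  calc (σ - 2) * (C * ‖X‖ * (‖Y‖ * ‖Z‖)) = C * ‖X‖ * ‖Y‖ * ((σ - 2) * ‖Z‖) := by ring
    _ ≤ C * A₂ * P * MG := by gcongr

/-- `‖∏_{v∈s} f v‖ ≤ ∏_{v∈s} B v` when `‖f v‖ ≤ B v` on `s`. [folklore] -/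
theorem norm_prod_le_prod_of_le {ι : Type*} {s : Finset ι} {f : ι → ℂ} (B : ι → ℝ) (h : ∀ v ∈ s, ‖f v‖ ≤ B v) :
    ‖∏ v ∈ s, f v‖ ≤ ∏ v ∈ s, B v := by
  rw [norm_prod]
  exact Finset.prod_le_prod (fun v _ => norm_nonneg _) h

variable (L : Type) [Field L] [NumberField L] [IsCMField L]
  [MeasurableSpace (quasiSplit (↥(maximalRealSubfield L)) L (IsCMField.complexConj L) 3).Adelic] [BorelSpace (quasiSplit (↥(maximalRealSubfield L)) L (IsCMField.complexConj L) 3).Adelic]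

omit [BorelSpace (quasiSplit (↥(maximalRealSubfield L)) L (IsCMField.complexConj L) 3).Adelic] in
/-- **The two currencies of the scalar agree**: the door's `(ν𝓕)⁻¹·∫ (H : ℂ)^{(σ:ℂ)}` is ★ FILE 3′'s `(ν𝓕)⁻¹ • ∫ ((H^σ : ℝ) : ℂ)` (`Complex.ofReal_cpow`, `H ≥ 0`). [folklore] -/
theorem inv_measure_mul_integral_cpow_eq (ν : Measure ↥(adelicUnipotent (↥(maximalRealSubfield L)) L (IsCMField.complexConj L) 3))
    (𝓕 : Set ↥(adelicUnipotent (↥(maximalRealSubfield L)) L (IsCMField.complexConj L) 3)) (σ : ℝ) :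
    (((((ν 𝓕).toReal⁻¹ : ℝ)) : ℂ) * (∫ v : ↥(adelicUnipotent (↥(maximalRealSubfield L)) L (IsCMField.complexConj L) 3), (((borelHeight (((quasiSplit (↥(maximalRealSubfield L)) L (IsCMField.complexConj L) 3).toAdelic (weylLongU ((IsCMField.complexConj L : L ≃ₐ[↥(maximalRealSubfield L)] L) : L →+* L) (rfl : (StdForm.antidiagonal 3).over L = (StdForm.antidiagonal 3).over L))) * (v : (quasiSplit (↥(maximalRealSubfield L)) L (IsCMField.complexConj L) 3).Adelic))) : ℝ) : ℂ) ^ ((σ : ℝ) : ℂ) ∂ν)) =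
      ((ν 𝓕).toReal⁻¹ : ℝ) • ∫ v : ↥(adelicUnipotent ↥(maximalRealSubfield L) L (IsCMField.complexConj L) 3),
          ((((borelHeight (((quasiSplit (↥(maximalRealSubfield L)) L (IsCMField.complexConj L) 3).toAdelic (weylLongU ((IsCMField.complexConj L : L ≃ₐ[↥(maximalRealSubfield L)] L) : L →+* L) (rfl : ((StdForm.antidiagonal 3).over L) = ((StdForm.antidiagonal 3).over L)))) * (v : (quasiSplit (↥(maximalRealSubfield L)) L (IsCMField.complexConj L) 3).Adelic))) : ℝ) ^ σ : ℝ) : ℂ) ∂ν := by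
  rw [Complex.real_smul]
  congr 1
  refine integral_congr_ae (Eventually.of_forall fun v => ?_)
  exact (Complex.ofReal_cpow (NNReal.coe_nonneg _) σ).symm

/-! ## §2 The scalar bound `(σ − 2)·‖c_ν(σ)‖ ≤ M` on `(2, 3]` -/

/-- **THE REAL-`σ` PAY-OUT.**  For the CM pair `L ∕ L⁺`, `δ ∈ L⁻ ∖ 0`, EVERY Haar measure `ν` on `N(𝔸_{L⁺})` and every fundamental domain `𝓕` of `N(L⁺)` with compact closure there is `M` with
`(σ − 2)·‖ν(𝓕)⁻¹·∫_{N(𝔸)} H(ι(w₀)v)^σ dν‖ ≤ M` for all real `σ ∈ (2, 3]` — ★ FILE 3′'s Euler product × ★ FILE 1's `G` (bounded on `[2,3]`) × ★ (α) (archimedean factor, uniformly bounded by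
its value at `σ = 2`) × ★ (β) (local factors at the bad places `S₀`, uniformly bounded by their values at `σ = 2`); no letter.
[cite: MoeglinWaldspurger1995, II.1.7, IV.1.11] [cite: Langlands1971, §3] [cite: Langlands1976, Appendix] -/
theorem sub_two_mul_norm_intertwiningScalar_le_cm_three {δ : L} (hcδ : IsCMField.complexConj L δ = -δ) (hδ : δ ≠ 0)
    (ν : Measure ↥(adelicUnipotent (↥(maximalRealSubfield L)) L (IsCMField.complexConj L) 3)) [ν.IsHaarMeasure]
    {𝓕 : Set ↥(adelicUnipotent (↥(maximalRealSubfield L)) L (IsCMField.complexConj L) 3)} (h𝓕N : IsFundamentalDomain ↥(rationalUnipotent (↥(maximalRealSubfield L)) L (IsCMField.complexConj L) 3) 𝓕 ν)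
    (h𝓕c : IsCompact (closure 𝓕)) :
    ∃ M : ℝ, ∀ σ : ℝ, 2 < σ → σ ≤ 2 + 1 → (σ - 2) * ‖(((((ν 𝓕).toReal⁻¹ : ℝ)) : ℂ) * (∫ v : ↥(adelicUnipotent (↥(maximalRealSubfield L)) L (IsCMField.complexConj L) 3), (((borelHeight (((quasiSplit (↥(maximalRealSubfield L)) L (IsCMField.complexConj L) 3).toAdelic (weylLongU ((IsCMField.complexConj L : L ≃ₐ[↥(maximalRealSubfield L)] L) : L →+* L) (rfl : (StdForm.antidiagonal 3).over L = (StdForm.antidiagonal 3).over L))) * (v : (quasiSplit (↥(maximalRealSubfield L)) L (IsCMField.complexConj L) 3).Adelic))) : ℝ) : ℂ) ^ ((σ : ℝ) : ℂ) ∂ν))‖ ≤ M := by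
  haveI : Algebra.IsQuadraticExtension ↥(maximalRealSubfield L) L := IsCMField.isQuadraticExtension L
  -- CM bookkeeping: `c² = 1 ≠ c`, Iwasawa, inversion invariance, `δ² = d ∈ L⁺`
  have hc : IsCMField.complexConj L * IsCMField.complexConj L = 1 := AlgEquiv.ext fun x => IsCMField.complexConj_apply_apply L x
  have hc1 : IsCMField.complexConj L ≠ 1 := IsCMField.complexConj_ne_one L
  haveI : ν.IsInvInvariant := isInvInvariant_of_isHaarMeasure_adelicUnipotent_three hc ν
  have hIw := exists_mem_borelAdelic_mul_mem_standardMaximalCompactGL_cm_three L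
  have hdmem : δ * δ ∈ maximalRealSubfield L := by
    rw [← IsCMField.complexConj_eq_self_iff, map_mul, hcδ, neg_mul_neg]
  have hd : δ * δ = algebraMap ↥(maximalRealSubfield L) L ⟨δ * δ, hdmem⟩ := rfl
  -- choices: Borel structures and Haar measures on the adelic pieces
  letI : MeasurableSpace (AdeleRing (𝓞 L) L) := borel _
  haveI : BorelSpace (AdeleRing (𝓞 L) L) := ⟨rfl⟩
  letI : MeasurableSpace (AdeleRing (𝓞 ↥(maximalRealSubfield L)) ↥(maximalRealSubfield L)) := borel _
  haveI : BorelSpace (AdeleRing (𝓞 ↥(maximalRealSubfield L)) ↥(maximalRealSubfield L)) := ⟨rfl⟩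
  letI : MeasurableSpace (InfiniteAdeleRing L) := borel _
  haveI : BorelSpace (InfiniteAdeleRing L) := ⟨rfl⟩
  letI : MeasurableSpace (InfiniteAdeleRing ↥(maximalRealSubfield L)) := borel _
  haveI : BorelSpace (InfiniteAdeleRing ↥(maximalRealSubfield L)) := ⟨rfl⟩
  letI : MeasurableSpace (FiniteAdeleRing (𝓞 L) L) := borel _
  haveI : BorelSpace (FiniteAdeleRing (𝓞 L) L) := ⟨rfl⟩
  letI : MeasurableSpace (FiniteAdeleRing (𝓞 ↥(maximalRealSubfield L)) ↥(maximalRealSubfield L)) := borel _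
  haveI : BorelSpace (FiniteAdeleRing (𝓞 ↥(maximalRealSubfield L)) ↥(maximalRealSubfield L)) := ⟨rfl⟩
  letI : ∀ v : HeightOneSpectrum (𝓞 ↥(maximalRealSubfield L)), MeasurableSpace (v.adicCompletion ↥(maximalRealSubfield L)) := fun v => borel _
  haveI : ∀ v : HeightOneSpectrum (𝓞 ↥(maximalRealSubfield L)), BorelSpace (v.adicCompletion ↥(maximalRealSubfield L)) := fun v => ⟨rfl⟩
  haveI := locallyCompactSpace_adeleRing' L
  haveI := locallyCompactSpace_adeleRing' ↥(maximalRealSubfield L)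
  haveI := locallyCompactSpace_finiteAdeleRing' L
  haveI := locallyCompactSpace_finiteAdeleRing' ↥(maximalRealSubfield L)
  haveI : ∀ v : HeightOneSpectrum (𝓞 ↥(maximalRealSubfield L)), LocallyCompactSpace (v.adicCompletion ↥(maximalRealSubfield L)) :=
    fun v => locallyCompactSpace_adicCompletion ↥(maximalRealSubfield L) v
  set μE : Measure (AdeleRing (𝓞 L) L) := Measure.addHaar with hμE
  set μE₁ : Measure (InfiniteAdeleRing L) := Measure.addHaar with hμE₁
  set μE₂ : Measure (FiniteAdeleRing (𝓞 L) L) := Measure.addHaar with hμE₂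
  set μF : Measure (AdeleRing (𝓞 ↥(maximalRealSubfield L)) ↥(maximalRealSubfield L)) := Measure.addHaar with hμF
  set μF₁ : Measure (InfiniteAdeleRing ↥(maximalRealSubfield L)) := Measure.addHaar with hμF₁
  set μF₂ : Measure (FiniteAdeleRing (𝓞 ↥(maximalRealSubfield L)) ↥(maximalRealSubfield L)) := Measure.addHaar with hμF₂
  set νv : ∀ v : HeightOneSpectrum (𝓞 ↥(maximalRealSubfield L)), Measure (v.adicCompletion ↥(maximalRealSubfield L)) := fun v => Measure.addHaar with hνv
  -- ★ FILE 3′: the Euler product for every real `σ > 2`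
  obtain ⟨C, hC, hEP⟩ := exists_pos_inv_measure_smul_integral_rpow_borelHeight_eq_eulerProduct_three' L hc hcδ hδ hc1 hIw hd ν h𝓕N μE μE₁ μE₂ μF μF₁ μF₂ νv
  -- the bad set `S₀`: ramified, above `2`, `δ` not a unit (cofinite suppliers ★)
  have e1 : ∀ᶠ v : HeightOneSpectrum (𝓞 ↥(maximalRealSubfield L)) in cofinite, Algebra.IsUnramifiedIn (𝓞 L) v.asIdeal :=
    Filter.eventually_cofinite.2 (Literature.NumberTheory.GaloisRepresentations.finite_setOf_not_isUnramifiedIn ↥(maximalRealSubfield L) L)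
  have e2 : ∀ᶠ v : HeightOneSpectrum (𝓞 ↥(maximalRealSubfield L)) in cofinite, Valued.v (2 : v.adicCompletion ↥(maximalRealSubfield L)) = 1 := by
    filter_upwards [eventually_valued_algebraMap_eq_one (E := ↥(maximalRealSubfield L)) (two_ne_zero : (2 : ↥(maximalRealSubfield L)) ≠ 0)] with v hv
    rwa [map_ofNat] at hv
  have e3 : ∀ᶠ v : HeightOneSpectrum (𝓞 ↥(maximalRealSubfield L)) in cofinite, ∀ w : PlacesOver L v, Valued.v (algebraMap L (LocalRing L v) δ w) = 1 :=
    eventually_forall_placesOver (F := ↥(maximalRealSubfield L)) (E := L) (eventually_valued_algebraMap_eq_one (E := L) hδ)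
  have e123 := e1.and (e2.and e3)
  rw [Filter.eventually_cofinite] at e123
  set S₀ : Finset (HeightOneSpectrum (𝓞 ↥(maximalRealSubfield L))) := e123.toFinset with hS₀
  have hgood : ∀ v ∉ S₀, Algebra.IsUnramifiedIn (𝓞 L) v.asIdeal ∧ Valued.v (2 : v.adicCompletion ↥(maximalRealSubfield L)) = 1 ∧
      ∀ w : PlacesOver L v, Valued.v (algebraMap L (LocalRing L v) δ w) = 1 := fun v hv => by
    by_contra h
    exact hv ((Set.Finite.mem_toFinset _).2 h)
  -- ★ FILE 1: `(σ − 2)·[N∕D](σ) = G σ`, `G` holomorphic on `{1 < re}`, hence bounded on `[2, 3]`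
  have hur : ∀ v ∉ (↑S₀ : Set (HeightOneSpectrum (𝓞 ↥(maximalRealSubfield L)))), (quadraticHeckeCharCM L).IsUnramifiedAt v := fun v hv =>
    Literature.NumberTheory.Rogawski1990.isUnramifiedAt_quadraticHeckeCharCM_of_isUnramifiedIn L (hgood v (fun h => hv (Finset.mem_coe.2 h))).1
  obtain ⟨G, hGd, hGeq, -⟩ := exists_differentiableOn_sub_two_mul_scalar_cm L S₀.finite_toSet hur
  have hK : IsCompact (((↑) : ℝ → ℂ) '' Icc (2 : ℝ) 3) := isCompact_Icc.image Complex.continuous_ofReal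
  have hGc : ContinuousOn G (((↑) : ℝ → ℂ) '' Icc (2 : ℝ) 3) := hGd.continuousOn.mono (by
    rintro z ⟨x, hx, rfl⟩
    show (1 : ℝ) < (x : ℂ).re
    rw [Complex.ofReal_re]
    linarith [hx.1])
  obtain ⟨MG, hMG⟩ := hK.exists_bound_of_continuousOn hGc
  -- the constants at `σ = 2`
  refine ⟨C * (∫ p : InfiniteAdeleRing L × InfiniteAdeleRing ↥(maximalRealSubfield L),
        (∏ w : InfinitePlace L, ((1 + ‖(p.1) w‖ ^ 2 / 2) ^ 2 + (w δ) ^ 2 * (((InfiniteAdeleRing.ringEquiv_mixedSpace ↥(maximalRealSubfield L)) p.2).1 ⟨w.comap (algebraMap ↥(maximalRealSubfield L) L), K2E1HeightBigCellLineFormulaU2.isReal_comap_maximalRealSubfield L w⟩) ^ 2)) ^ (-(2 : ℝ)) ∂(μE₁.prod μF₁)) *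
      (∏ v ∈ S₀, ((Measure.pi fun _ : Fin 3 => νv v) (integralBox ↥(maximalRealSubfield L) (Fin 3) v)).toReal⁻¹ *
        ∫ p : Fin 3 → v.adicCompletion ↥(maximalRealSubfield L),
          (∏ w' : PlacesOver L v, max 1 (max ((normAbs (w'.1.adicCompletion L) (quadraticLocalEquiv L v (IsCMField.complexConj L) hcδ hδ (p 0, p 1) w') : ℝ≥0) : ℝ)
            ((normAbs (w'.1.adicCompletion L) ((toLocalRing L v (p 2) * algebraMap L (LocalRing L v) δ -
              toLocalRing L v 2⁻¹ * (quadraticLocalEquiv L v (IsCMField.complexConj L) hcδ hδ (p 0, p 1) *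
                conjLocal L (IsCMField.complexConj L) v (quadraticLocalEquiv L v (IsCMField.complexConj L) hcδ hδ (p 0, p 1)))) w') : ℝ≥0) : ℝ))) ^ (-(2 : ℝ))
          ∂(Measure.pi fun _ : Fin 3 => νv v)) * MG, fun σ hσ hσ3 => ?_⟩
  -- `hT` (Godement at CM, ★) and the Euler product at `σ`
  have hT : Integrable (fun v : ↥(adelicUnipotent ↥(maximalRealSubfield L) L (IsCMField.complexConj L) 3) =>
      ((((borelHeight (((quasiSplit (↥(maximalRealSubfield L)) L (IsCMField.complexConj L) 3).toAdelic (weylLongU ((IsCMField.complexConj L : L ≃ₐ[↥(maximalRealSubfield L)] L) : L →+* L) (rfl : ((StdForm.antidiagonal 3).over L) = ((StdForm.antidiagonal 3).over L)))) * (v : (quasiSplit (↥(maximalRealSubfield L)) L (IsCMField.complexConj L) 3).Adelic))) : ℝ) ^ σ : ℝ) : ℂ)) ν := by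
    have h := Complex.ofRealCLM.integrable_comp (integrable_borelHeight_weylLongU_mul_rpow_cm_three L ν h𝓕N h𝓕c hσ 1)
    simp_rw [mul_one] at h
    exact h
  have hE := hEP S₀ hgood hσ hT
  rw [← inv_measure_mul_integral_cpow_eq L ν 𝓕 σ] at hE
  have hσ2 : (2 : ℝ) ≤ σ := hσ.le
  refine payout_arith hC.le hσ hE (norm_integral_integral_arch_rpow_le L hδ μE₁ μF₁ one_lt_two hσ2)
    (norm_prod_le_prod_of_le _ fun v _ => norm_localMean_le_cm L hcδ hδ hd v (νv v) (by norm_num) hσ2) (hGeq (σ : ℂ) (by rwa [Complex.ofReal_re])) (hMG _ ⟨σ, ⟨hσ2, by linarith⟩, rfl⟩)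

/-! ## §3 (R-b)₃ LETTER-FREE -/

/-- **(R-b)₃ — THE `(σ, g)`-UNIFORM RESIDUE MAJORANT OF THE SPHERICAL `U(2,1)` EISENSTEIN SERIES NEAR ITS POLE, NO LETTER.**  For the CM pair `L ∕ L⁺`, `δ ∈ L⁻ ∖ 0`, every Haar `ν`
on `N(𝔸_{L⁺})`, every fundamental domain `𝓕` of `N(L⁺)` with compact closure, `φ₀ : ℂ` and ANY `A > 2`:
`∃ η > 0, ∃ C ≥ 0, ∀ σ ∈ (2, 2 + η], ∀ g, (σ − 2)·‖E(φ₀H^σ)(g)‖ ≤ C·(sup_γ H(γg))^A` — ★ `residue_uniform_majorant_cm_three_of_cbound` with its scalar letter `hcb` DISCHARGED by §2.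
[cite: MoeglinWaldspurger1995, II.1.5, II.1.7 and IV.1.9] [cite: Garrett2018, §2.8 and §3.10] -/
theorem residue_uniform_majorant_cm_three {δ : L} (hcδ : IsCMField.complexConj L δ = -δ) (hδ : δ ≠ 0)
    (ν : Measure ↥(adelicUnipotent (↥(maximalRealSubfield L)) L (IsCMField.complexConj L) 3)) [ν.IsHaarMeasure]
    {𝓕 : Set ↥(adelicUnipotent (↥(maximalRealSubfield L)) L (IsCMField.complexConj L) 3)} (h𝓕N : IsFundamentalDomain ↥(rationalUnipotent (↥(maximalRealSubfield L)) L (IsCMField.complexConj L) 3) 𝓕 ν)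
    (h𝓕c : IsCompact (closure 𝓕)) (φ₀ : ℂ) {A : ℝ} (hA : 2 < A) :
    ∃ η : ℝ, 0 < η ∧ ∃ C : ℝ, 0 ≤ C ∧ ∀ σ : ℝ, 2 < σ → σ ≤ 2 + η → ∀ g : (quasiSplit (↥(maximalRealSubfield L)) L (IsCMField.complexConj L) 3).Adelic,
      (σ - 2) * ‖eisensteinSeriesU (flatSectionU (fun _ : (quasiSplit (↥(maximalRealSubfield L)) L (IsCMField.complexConj L) 3).Adelic => φ₀) ((σ : ℝ) : ℂ)) (g)‖ ≤ C * (((⨆ γ : (quasiSplit (↥(maximalRealSubfield L)) L (IsCMField.complexConj L) 3).arithmeticSubgroup, borelHeight ((γ : (quasiSplit (↥(maximalRealSubfield L)) L (IsCMField.complexConj L) 3).Adelic) * g)) : ℝ≥0) : ℝ) ^ A := by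
  obtain ⟨M, hM⟩ := sub_two_mul_norm_intertwiningScalar_le_cm_three L hcδ hδ ν h𝓕N h𝓕c
  exact residue_uniform_majorant_cm_three_of_cbound L ν h𝓕N h𝓕c one_pos hM φ₀ hA

/-- **(R-b)₃, HEIGHT FORM** (all `g`, no letter): `(σ − 2)·‖E(φ₀H^σ)(g)‖ ≤ C·max(H(g), H(g)⁻¹)^A` on `(2, 2 + η]`. [cite: MoeglinWaldspurger1995, I.2.2 and II.1.5] -/
theorem residue_uniform_majorant_cm_three_le_max {δ : L} (hcδ : IsCMField.complexConj L δ = -δ) (hδ : δ ≠ 0)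
    (ν : Measure ↥(adelicUnipotent (↥(maximalRealSubfield L)) L (IsCMField.complexConj L) 3)) [ν.IsHaarMeasure]
    {𝓕 : Set ↥(adelicUnipotent (↥(maximalRealSubfield L)) L (IsCMField.complexConj L) 3)} (h𝓕N : IsFundamentalDomain ↥(rationalUnipotent (↥(maximalRealSubfield L)) L (IsCMField.complexConj L) 3) 𝓕 ν)
    (h𝓕c : IsCompact (closure 𝓕)) (φ₀ : ℂ) {A : ℝ} (hA : 2 < A) :
    ∃ η : ℝ, 0 < η ∧ ∃ C : ℝ, 0 ≤ C ∧ ∀ σ : ℝ, 2 < σ → σ ≤ 2 + η → ∀ g : (quasiSplit (↥(maximalRealSubfield L)) L (IsCMField.complexConj L) 3).Adelic,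
      (σ - 2) * ‖eisensteinSeriesU (flatSectionU (fun _ : (quasiSplit (↥(maximalRealSubfield L)) L (IsCMField.complexConj L) 3).Adelic => φ₀) ((σ : ℝ) : ℂ)) (g)‖ ≤ C * (max (borelHeight g : ℝ) (borelHeight g : ℝ)⁻¹) ^ A := by
  obtain ⟨M, hM⟩ := sub_two_mul_norm_intertwiningScalar_le_cm_three L hcδ hδ ν h𝓕N h𝓕c
  exact residue_uniform_majorant_cm_three_of_cbound_le_max L ν h𝓕N h𝓕c one_pos hM φ₀ hA

/-- **(R-b)₃, SIEGEL-SET FORM** (no letter): `(σ − 2)·‖E(φ₀H^σ)(g)‖ ≤ C·H(g)^A` on `{1 ≤ H}`, `σ ∈ (2, 2 + η]`. [cite: MoeglinWaldspurger1995, I.2.2 and II.1.5] [cite: Garrett2018, §2.8] -/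
theorem residue_uniform_majorant_cm_three_siegel {δ : L} (hcδ : IsCMField.complexConj L δ = -δ) (hδ : δ ≠ 0)
    (ν : Measure ↥(adelicUnipotent (↥(maximalRealSubfield L)) L (IsCMField.complexConj L) 3)) [ν.IsHaarMeasure]
    {𝓕 : Set ↥(adelicUnipotent (↥(maximalRealSubfield L)) L (IsCMField.complexConj L) 3)} (h𝓕N : IsFundamentalDomain ↥(rationalUnipotent (↥(maximalRealSubfield L)) L (IsCMField.complexConj L) 3) 𝓕 ν)
    (h𝓕c : IsCompact (closure 𝓕)) (φ₀ : ℂ) {A : ℝ} (hA : 2 < A) :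
    ∃ η : ℝ, 0 < η ∧ ∃ C : ℝ, 0 ≤ C ∧ ∀ σ : ℝ, 2 < σ → σ ≤ 2 + η → ∀ g : (quasiSplit (↥(maximalRealSubfield L)) L (IsCMField.complexConj L) 3).Adelic, 1 ≤ borelHeight g →
      (σ - 2) * ‖eisensteinSeriesU (flatSectionU (fun _ : (quasiSplit (↥(maximalRealSubfield L)) L (IsCMField.complexConj L) 3).Adelic => φ₀) ((σ : ℝ) : ℂ)) (g)‖ ≤ C * (borelHeight g : ℝ) ^ A := by
  obtain ⟨M, hM⟩ := sub_two_mul_norm_intertwiningScalar_le_cm_three L hcδ hδ ν h𝓕N h𝓕c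
  exact residue_uniform_majorant_cm_three_of_cbound_siegel L ν h𝓕N h𝓕c one_pos hM φ₀ hA

end Summit.HodgeConjecture.HodgeConjecture.Cruxes.H413.K2E1ResidueUniformMajorantCMThreeScalar

end
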